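import Literature.Topology.FourManifolds.SliceDiscConicalTubeFraming
import Literature.Topology.FourManifolds.NormalFrameTransport
import Literature.Topology.FourManifolds.TubularNbhdReframe
import HarnessLib

/-!
# Preliminaries for the conical transversal framing of a conical slice disc

Topic `Literature/Topology/FourManifolds`; tools for the discharge of the named fact
`Literature.Topology.FourManifolds.Knot.IsSliceDisc.exists_conicalTube_hasFraming_zero`
(`SliceDiscEndCollarFacts.lean`; Kosinski, *Differential Manifolds* (1993), Ch. III (4.1)–(4.2): a
neat submanifold has a neat tubular neighbourhood), the open leaf under Manolescu–Piccirillo (2023),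
Lemma 3.3 for `W = S⁴`. After `SliceDiscConicalTube.lean` and `SliceDiscConicalTubeFraming.lean` the
fact follows from a `ConicalFraming` datum: a transversal framing of the conical slice disc which over a
band is the cone on the fibre derivative of an oriented tubular neighbourhood of the knot. The sequel
`SliceDiscConicalFramingExistence.lean` builds that datum from the global normal frame of
`NormalFrameTransport.lean` and the reframing of `TubularNbhdReframe.lean`; this file holds the pieces
of that construction which are independent of the choices made there. Everything is proved; no named
facts are introduced.

* § Openness: linear independence of a continuous family of finite families of vectors persists on a
  uniform thickening of a compact set (`exists_thickening_linearIndependent`, from Mathlib's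
  `isOpen_setOf_linearIndependent` and `IsCompact.exists_thickening_subset_open`).
* § Calculus: partial versus total derivatives on a product; the derivative of a positively homogeneous
  map is constant along rays (`fderiv_smul_eq_of_homogeneous`).
* § The cone on the knot: `Knot.TubularNbhd.coneSec ν y = ν.coneTube (y, 0) = ‖y‖ • K(y/‖y‖)`; a slice
  disc `g` which is this cone on the band `1 - s₁ ≤ ‖y‖ ≤ 1` has `Dg(t • u) = D(coneSec)(u)` for all
  `1 - s₁ ≤ t < 1` (`fderiv_eq_fderiv_coneSec_of_cone`, including the inner edge `t = 1 - s₁` by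
  continuity of the derivatives), and the fibre derivatives of `ν.coneTube` along the zero section are
  transversal to it (`transversal_coneTube_fibre`).
* § Radial reparametrisations: the **radial cut-off** `radialCut γ₁ γ₂` (`0` on `‖x‖ ≤ γ₁`, `1` on
  `‖x‖ ≥ γ₂`, smooth) and the **radial push** `radialPush α β r₀` built on it (identity on `‖x‖ ≤ α`,
  the retraction `x ↦ r₀ • x/‖x‖` on `‖x‖ ≥ β`, smooth, direction-preserving).
* § Linear algebra of frames: `frameCLM B a = ∑ aⱼ • Bⱼ`, its injectivity for an independent pair, the
  coefficient map `frameCoeff B z = (βᵀβ)⁻¹ βᵀ z` (smooth in `(B, z)` by `NormalFrameTransport.lean`)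
  with `∑ (frameCoeff B z)ⱼ • Bⱼ = z` for `z` in the span; a normal vector lies in the span of a normal
  independent pair (`exists_sum_smul_eq_of_normProj_eq`, dimension count); an independent pair of plane
  vectors has nonzero determinant.

## References

* A. A. Kosinski, *Differential Manifolds* (1993), Ch. III (4.1)–(4.2). [cite: Kosinski1993, Ch. III Thm (4.2)]
* M. W. Hirsch, *Differential Topology*, GTM 33 (1976), Ch. 4 §2, §5. [cite: HirschDT1976, Ch. 4 §5 Thm. 5.1]

## Mathlib / tree search

Two declarations have close relatives elsewhere in the tree, deliberately not imported because their
home `Literature/Analysis/FluidPDE/NewtonKernel.lean` would drag the Navier–Stokes import chain into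
`FourManifolds`: `fderiv_smul_eq_of_homogeneous` is the degree-one, differentiable case of
`Literature.Analysis.FluidPDE.fderiv_homogeneous`, and `radialCut` is (one minus) the shape of
`Literature.Analysis.FluidPDE.radialCutoff`. A librarian may later hoist both into a generic
`Literature/Analysis/Calculus` file and point the two topics at it. Everything else (`coneSec`,
`radialPush`, `frameCLM`/`frameCoeff`, `exists_sum_smul_eq_of_normProj_eq`,
`det_two_ne_zero_of_linearIndependent`, `exists_thickening_linearIndependent`) has no prior
counterpart (`lean search`).

## Design notes

* All functions are bare maps of `ℝ²`, `ℝ² × ℝ²`, `ℝ⁴`; the circle enters only through points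
  `t • (u : ℝ²)`, `u ∈ 𝕊¹`.
* No `sorry`; the usual local notation and the two local finite-dimensionality `Fact`s.
-/

noncomputable section

open Set Metric Function Filter
open scoped Manifold ContDiff Topology RealInnerProductSpace

namespace Literature.Topology.FourManifolds

/-- Local notation: `𝔼 n` is the model Euclidean space `EuclideanSpace ℝ (Fin n)`. -/
local notation "𝔼 " n:arg => EuclideanSpace ℝ (Fin n)

/-- Local notation: `𝕊 n` is the unit sphere in `EuclideanSpace ℝ (Fin (n + 1))`. -/
local notation "𝕊 " n:arg => (Metric.sphere (0 : EuclideanSpace ℝ (Fin (n + 1))) 1)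

attribute [local instance] fact_finrank_euclideanSpace_two fact_finrank_euclideanSpace_four

/-! ### Openness of linear independence, uniformly near a compact set -/

section Openness

variable {X : Type*} [PseudoMetricSpace X] {ι : Type*} [Finite ι] {F : Type*} [NormedAddCommGroup F]
  [NormedSpace ℝ F]

/-- **Linear independence persists on a uniform thickening of a compact set.** If `v : X → (ι → F)` is
continuous on an open set `U` and `v p` is linearly independent for every `p` in a compact `S ⊆ U`,
then it is linearly independent on some `δ`-thickening of `S` (inside `U`). [folklore] -/
theorem exists_thickening_linearIndependent {U : Set X} (hU : IsOpen U) {v : X → ι → F}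
    (hv : ContinuousOn v U) {S : Set X} (hS : IsCompact S) (hSU : S ⊆ U)
    (hind : ∀ p ∈ S, LinearIndependent ℝ (v p)) :
    ∃ δ : ℝ, 0 < δ ∧ ∀ p ∈ thickening δ S, p ∈ U ∧ LinearIndependent ℝ (v p) := by
  have hO : IsOpen (U ∩ v ⁻¹' {f : ι → F | LinearIndependent ℝ f}) :=
    hv.isOpen_inter_preimage hU isOpen_setOf_linearIndependent
  obtain ⟨δ, hδ, hsub⟩ := hS.exists_thickening_subset_open hO fun p hp ↦ ⟨hSU hp, hind p hp⟩
  exact ⟨δ, hδ, fun p hp ↦ hsub hp⟩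

end Openness

/-! ### Calculus on products and along rays -/

section Calculus

variable {E₁ E₂ G : Type*} [NormedAddCommGroup E₁] [NormedSpace ℝ E₁] [NormedAddCommGroup E₂]
  [NormedSpace ℝ E₂] [NormedAddCommGroup G] [NormedSpace ℝ G]

/-- **Partial derivative in the second variable** as the total derivative on `(0, v)`. [folklore] -/
theorem fderiv_comp_prodMk_right (f : E₁ × E₂ → G) {x : E₁} {y : E₂}
    (hf : DifferentiableAt ℝ f (x, y)) (v : E₂) :
    fderiv ℝ (fun y' ↦ f (x, y')) y v = fderiv ℝ f (x, y) (0, v) := by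
  have h : HasFDerivAt (fun y' ↦ f (x, y')) ((fderiv ℝ f (x, y)).comp (ContinuousLinearMap.inr ℝ E₁ E₂)) y :=
    hf.hasFDerivAt.comp y (hasFDerivAt_prodMk_right x y)
  rw [h.fderiv]
  rfl

/-- **Partial derivative in the first variable** as the total derivative on `(v, 0)`. [folklore] -/
theorem fderiv_comp_prodMk_left (f : E₁ × E₂ → G) {x : E₁} {y : E₂}
    (hf : DifferentiableAt ℝ f (x, y)) (v : E₁) :
    fderiv ℝ (fun x' ↦ f (x', y)) x v = fderiv ℝ f (x, y) (v, 0) := by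
  have h : HasFDerivAt (fun x' ↦ f (x', y)) ((fderiv ℝ f (x, y)).comp (ContinuousLinearMap.inl ℝ E₁ E₂)) x :=
    hf.hasFDerivAt.comp x (hasFDerivAt_prodMk_left x y)
  rw [h.fderiv]
  rfl

/-- A linear map on a product splits over the two factors. [folklore] -/
theorem clm_prod_apply_eq_add (L : E₁ × E₂ →L[ℝ] G) (v : E₁) (w : E₂) :
    L (v, w) = L (v, 0) + L (0, w) := by
  rw [← map_add]; simp

/-- **The derivative of a positively homogeneous map is constant along rays**: if
`c (s • y) = s • c y` for all `s > 0` and `c` is differentiable at `y` and `s • y`, then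
`Dc(s • y) = Dc(y)`. (The tree's `Literature.Analysis.FluidPDE.fderiv_homogeneous`,
`Analysis/FluidPDE/NewtonKernel.lean`, is the same statement for homogeneity of any degree and without
differentiability hypotheses; it is not imported here to keep the Navier–Stokes import chain out of
this topic.) [folklore] -/
theorem fderiv_smul_eq_of_homogeneous {c : E₁ → G} (hc : ∀ s : ℝ, 0 < s → ∀ y, c (s • y) = s • c y)
    {y : E₁} {s : ℝ} (hs : 0 < s) (hd : DifferentiableAt ℝ c (s • y)) (hd' : DifferentiableAt ℝ c y) :
    fderiv ℝ c (s • y) = fderiv ℝ c y := by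
  have h1 : (c ∘ fun z : E₁ ↦ s • z) = fun z ↦ s • c z := funext (hc s hs)
  have hsmul : HasFDerivAt (fun z : E₁ ↦ s • z) (s • ContinuousLinearMap.id ℝ E₁) y :=
    (s • ContinuousLinearMap.id ℝ E₁).hasFDerivAt
  have h2 : fderiv ℝ (c ∘ fun z : E₁ ↦ s • z) y = (fderiv ℝ c (s • y)).comp (s • ContinuousLinearMap.id ℝ E₁) := by
    rw [fderiv_comp y hd hsmul.differentiableAt, hsmul.fderiv]
  have h3 : fderiv ℝ (fun z ↦ s • c z) y = s • fderiv ℝ c y := fderiv_const_smul hd' s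
  rw [h1, h3, ContinuousLinearMap.comp_smul, ContinuousLinearMap.comp_id] at h2
  exact (smul_right_injective (E₁ →L[ℝ] G) hs.ne' h2).symm

end Calculus

/-! ### The cone on the knot and conical derivative identities -/

namespace Knot.TubularNbhd

variable {K : 𝕊 1 → 𝕊 3} (ν : Knot.TubularNbhd K)

/-- The **cone on the knot**, `y ↦ ‖y‖ • K(y/‖y‖)`, as the zero section of the cone tube of any
tubular neighbourhood (`coneTube_fst_zero`). [folklore] -/
def coneSec (y : 𝔼 2) : 𝔼 4 := ν.coneTube (y, 0)

/-- Unfolding of `coneSec`. [folklore] -/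
theorem coneSec_apply (y : 𝔼 2) : ν.coneSec y = ν.coneTube (y, 0) := rfl

/-- The cone on a cone point: `coneSec (t • u) = t • K u`. [folklore] -/
theorem coneSec_smul_coe {t : ℝ} (ht : 0 < t) (u : 𝕊 1) :
    ν.coneSec (t • (u : 𝔼 2)) = t • ((K u : 𝕊 3) : 𝔼 4) :=
  ν.coneTube_smul_coe_zero ht u

/-- Homogeneity of the cone. [folklore] -/
theorem coneSec_smul {s : ℝ} (hs : 0 < s) (y : 𝔼 2) : ν.coneSec (s • y) = s • ν.coneSec y :=
  ν.coneTube_smul_fst hs y 0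

/-- The cone is `C^∞` off the origin. [folklore] -/
theorem contDiffOn_coneSec : ContDiffOn ℝ ∞ ν.coneSec {y : 𝔼 2 | y ≠ 0} :=
  ν.contDiffOn_coneTube.comp (contDiffOn_id.prodMk contDiffOn_const) fun _ hy ↦ hy

/-- The cone is `C^∞` at every point off the origin. [folklore] -/
theorem contDiffAt_coneSec {y : 𝔼 2} (hy : y ≠ 0) : ContDiffAt ℝ ∞ ν.coneSec y :=
  ν.contDiffOn_coneSec.contDiffAt (isOpen_ne.mem_nhds hy)

/-- **The derivative of the cone is constant along rays.** [folklore] -/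
theorem fderiv_coneSec_smul {y : 𝔼 2} (hy : y ≠ 0) {s : ℝ} (hs : 0 < s) :
    fderiv ℝ ν.coneSec (s • y) = fderiv ℝ ν.coneSec y :=
  fderiv_smul_eq_of_homogeneous (fun s hs y ↦ ν.coneSec_smul hs y) hs
    ((ν.contDiffAt_coneSec (smul_ne_zero hs.ne' hy)).differentiableAt (by simp))
    ((ν.contDiffAt_coneSec hy).differentiableAt (by simp))

/-- The derivative of the cone is continuous off the origin. [folklore] -/
theorem continuousOn_fderiv_coneSec : ContinuousOn (fderiv ℝ ν.coneSec) {y : 𝔼 2 | y ≠ 0} :=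
  ν.contDiffOn_coneSec.continuousOn_fderiv_of_isOpen isOpen_ne (by simp)

section Cone

variable {g : 𝔼 2 → 𝔼 4} {s₁ : ℝ} (hg : ContDiff ℝ ∞ g) (hs₁ : 0 < s₁) (hs₁' : s₁ < 1)
  (hcone : ∀ (u : 𝕊 1) (t : ℝ), 1 - s₁ ≤ t → t ≤ 1 → g (t • (u : 𝔼 2)) = t • ((K u : 𝕊 3) : 𝔼 4))
include hcone

/-- A disc conical on the band agrees with the cone there (Cartesian form). [folklore] -/
theorem eq_coneSec_of_cone {y : 𝔼 2} (h1 : 1 - s₁ ≤ ‖y‖) (h2 : ‖y‖ ≤ 1) (h0 : 0 < ‖y‖) :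
    g y = ν.coneSec y := by
  set u : 𝕊 1 := radialProjection (spherePt 1) y
  have hy : ‖y‖ • (u : 𝔼 2) = y := norm_smul_coe_radialProjection _ y
  rw [← hy, hcone u ‖y‖ h1 h2, ν.coneSec_smul_coe h0]

include hs₁' in
/-- On the open band the derivative of the disc is that of the cone. [folklore] -/
theorem fderiv_eq_fderiv_coneSec_of_mem {y : 𝔼 2} (h1 : 1 - s₁ < ‖y‖) (h2 : ‖y‖ < 1) :
    fderiv ℝ g y = fderiv ℝ ν.coneSec y := by
  have hO : IsOpen {z : 𝔼 2 | 1 - s₁ < ‖z‖ ∧ ‖z‖ < 1} :=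
    (isOpen_lt continuous_const continuous_norm).inter (isOpen_lt continuous_norm continuous_const)
  have hev : g =ᶠ[𝓝 y] ν.coneSec :=
    Filter.eventuallyEq_of_mem (hO.mem_nhds ⟨h1, h2⟩) fun z hz ↦
      eq_coneSec_of_cone ν hcone hz.1.le hz.2.le (by linarith [hz.1])
  exact hev.fderiv_eq

include hg hs₁ hs₁' in
/-- **The derivative of a conical disc along a conical ray**: for `u ∈ 𝕊¹` and `1 - s₁ ≤ t < 1`,
`Dg(t • u) = D(coneSec)(u)` — on the open band by local agreement and homogeneity, at the inner edge
`t = 1 - s₁` by continuity of both derivatives. [folklore] -/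
theorem fderiv_eq_fderiv_coneSec_of_cone (u : 𝕊 1) {t : ℝ} (ht : 1 - s₁ ≤ t) (ht' : t < 1) :
    fderiv ℝ g (t • (u : 𝔼 2)) = fderiv ℝ ν.coneSec (u : 𝔼 2) := by
  have hu0 : (u : 𝔼 2) ≠ 0 := ne_zero_of_mem_unit_sphere u
  have hnorm : ∀ r : ℝ, 0 < r → ‖r • (u : 𝔼 2)‖ = r := fun r hr ↦ norm_smul_coe_sphere hr.le u
  -- the two derivative curves along the ray
  set F₁ : ℝ → (𝔼 2 →L[ℝ] 𝔼 4) := fun r ↦ fderiv ℝ g (r • (u : 𝔼 2)) with hF₁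
  set F₂ : ℝ → (𝔼 2 →L[ℝ] 𝔼 4) := fun r ↦ fderiv ℝ ν.coneSec (r • (u : 𝔼 2)) with hF₂
  have hray : Continuous fun r : ℝ ↦ r • (u : 𝔼 2) := continuous_id.smul continuous_const
  have hF₁c : Continuous F₁ := (hg.continuous_fderiv (by simp)).comp hray
  have hF₂c : ContinuousOn F₂ (Icc (1 - s₁) 1) :=
    ν.continuousOn_fderiv_coneSec.comp hray.continuousOn fun r hr ↦
      smul_ne_zero (by linarith [hr.1]) hu0
  have heq : EqOn F₁ F₂ (Ioo (1 - s₁) 1) := fun r hr ↦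
    fderiv_eq_fderiv_coneSec_of_mem ν hs₁' hcone (by rw [hnorm r (by linarith [hr.1])]; exact hr.1)
      (by rw [hnorm r (by linarith [hr.1])]; exact hr.2)
  have hcl : Icc (1 - s₁) 1 ⊆ closure (Ioo (1 - s₁) 1) := by
    rw [closure_Ioo (by linarith)]
  have key : EqOn F₁ F₂ (Icc (1 - s₁) 1) :=
    heq.of_subset_closure hF₁c.continuousOn hF₂c Ioo_subset_Icc_self hcl
  have h := key ⟨ht, ht'.le⟩
  simp only [hF₁, hF₂] at h
  rw [h, ν.fderiv_coneSec_smul hu0 (by linarith)]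

include ν hg hs₁ hs₁' in
/-- In particular the derivative of a conical disc is constant along each conical ray:
`Dg(t • u) = Dg(t' • u)` for `t, t' ∈ [1 - s₁, 1)`. [folklore] -/
theorem fderiv_smul_eq_fderiv_smul_of_cone (u : 𝕊 1) {t t' : ℝ} (ht : 1 - s₁ ≤ t) (ht₁ : t < 1)
    (ht' : 1 - s₁ ≤ t') (ht'₁ : t' < 1) :
    fderiv ℝ g (t • (u : 𝔼 2)) = fderiv ℝ g (t' • (u : 𝔼 2)) := by
  rw [fderiv_eq_fderiv_coneSec_of_cone ν hg hs₁ hs₁' hcone u ht ht₁,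
    fderiv_eq_fderiv_coneSec_of_cone ν hg hs₁ hs₁' hcone u ht' ht'₁]

end Cone

/-- **The fibre derivatives of the cone tube along the zero section are transversal to the cone**: at
`x ≠ 0`, `D(coneSec)(x) v + D_w (coneTube (x, ·))|₀ a = 0` forces `v = 0`, `a = 0` (the cone tube is an
immersion, `injective_fderiv_coneTube`). [folklore] -/
theorem transversal_coneTube_fibre {x : 𝔼 2} (hx : x ≠ 0) (v a : 𝔼 2)
    (h : fderiv ℝ ν.coneSec x v + fderiv ℝ (fun w : 𝔼 2 ↦ ν.coneTube (x, w)) 0 a = 0) :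
    v = 0 ∧ a = 0 := by
  have hd : DifferentiableAt ℝ ν.coneTube (x, 0) :=
    (ν.contDiffAt_coneTube (q := (x, 0)) hx).differentiableAt (by simp)
  have h1 : fderiv ℝ ν.coneSec x v = fderiv ℝ ν.coneTube (x, 0) (v, 0) :=
    fderiv_comp_prodMk_left ν.coneTube hd v
  have h2 : fderiv ℝ (fun w : 𝔼 2 ↦ ν.coneTube (x, w)) 0 a = fderiv ℝ ν.coneTube (x, 0) (0, a) :=
    fderiv_comp_prodMk_right ν.coneTube hd a
  rw [h1, h2, ← clm_prod_apply_eq_add] at h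
  have := (injective_iff_map_eq_zero _).1 (ν.injective_fderiv_coneTube (q := (x, 0)) hx) _ h
  exact ⟨congrArg Prod.fst this, congrArg Prod.snd this⟩

/-- The fibre derivative of the cone tube along the zero section, applied to `a`, is the combination
`∑ aⱼ • D_w|₀ coneTube (x, ·) eⱼ`. [folklore] -/
theorem fderiv_coneTube_fibre_apply (x a : 𝔼 2) :
    fderiv ℝ (fun w : 𝔼 2 ↦ ν.coneTube (x, w)) 0 a =
      ∑ j : Fin 2, a j • fderiv ℝ (fun w : 𝔼 2 ↦ ν.coneTube (x, w)) 0 (EuclideanSpace.single j 1) := by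
  conv_lhs => rw [euclideanSpace_two_decomp a]
  rw [map_add, map_smul, map_smul, Fin.sum_univ_two]

end Knot.TubularNbhd

/-! ### Radial reparametrisations of the plane -/

section Radial

/-- **The radial cut-off** `radialCut γ₁ γ₂`: `0` on `‖x‖ ≤ γ₁`, `1` on `‖x‖ ≥ γ₂`, Mathlib's
`Real.smoothTransition` in `‖x‖` (compare the tree's `Literature.Analysis.FluidPDE.radialCutoff` of
`Analysis/FluidPDE/NewtonKernel.lean`, which is `1 -` such a cut-off in a general normed space; it is
not imported here to keep the Navier–Stokes import chain out of this topic). [folklore] -/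
def radialCut (γ₁ γ₂ : ℝ) (x : 𝔼 2) : ℝ := Real.smoothTransition ((‖x‖ - γ₁) / (γ₂ - γ₁))

variable {γ₁ γ₂ : ℝ}

/-- The cut-off lies in `[0, 1]`. [folklore] -/
theorem radialCut_mem (x : 𝔼 2) : radialCut γ₁ γ₂ x ∈ Icc (0 : ℝ) 1 :=
  ⟨Real.smoothTransition.nonneg _, Real.smoothTransition.le_one _⟩

/-- The cut-off vanishes on `‖x‖ ≤ γ₁`. [folklore] -/
theorem radialCut_of_le (hγ : γ₁ < γ₂) {x : 𝔼 2} (hx : ‖x‖ ≤ γ₁) : radialCut γ₁ γ₂ x = 0 :=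
  Real.smoothTransition.zero_of_nonpos (div_nonpos_of_nonpos_of_nonneg (by linarith) (by linarith))

/-- The cut-off is `1` on `γ₂ ≤ ‖x‖`. [folklore] -/
theorem radialCut_of_ge (hγ : γ₁ < γ₂) {x : 𝔼 2} (hx : γ₂ ≤ ‖x‖) : radialCut γ₁ γ₂ x = 1 :=
  Real.smoothTransition.one_of_one_le ((one_le_div (by linarith)).2 (by linarith))

/-- **The cut-off is `C^∞`** (for `0 < γ₁ < γ₂`): near the origin it vanishes identically, elsewhere it is
a smooth formula. [folklore] -/
theorem contDiff_radialCut (hγ₁ : 0 < γ₁) (hγ : γ₁ < γ₂) : ContDiff ℝ ∞ (radialCut γ₁ γ₂) := by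
  rw [contDiff_iff_contDiffAt]
  intro x
  by_cases hx : ‖x‖ < γ₁
  · have hev : radialCut γ₁ γ₂ =ᶠ[𝓝 x] fun _ ↦ 0 :=
      Filter.eventuallyEq_of_mem ((isOpen_lt continuous_norm continuous_const).mem_nhds hx)
        fun y hy ↦ radialCut_of_le hγ (le_of_lt hy)
    exact contDiffAt_const.congr_of_eventuallyEq hev
  · have hx0 : x ≠ 0 := by
      rw [← norm_pos_iff]; linarith [not_lt.1 hx]
    exact Real.smoothTransition.contDiffAt.comp x
      (((contDiffAt_norm ℝ hx0).sub contDiffAt_const).div_const _)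

/-- **The radial push** `radialPush α β r₀`: the identity on `‖x‖ ≤ α`, the radial retraction
`x ↦ r₀ • x/‖x‖` on `‖x‖ ≥ β`, interpolated by the cut-off `radialCut α β`. [folklore] -/
def radialPush (α β r₀ : ℝ) (x : 𝔼 2) : 𝔼 2 := x + radialCut α β x • ((r₀ / ‖x‖) • x - x)

variable {α β r₀ : ℝ}

/-- **The radial push is a radial rescaling**: `radialPush x = c • x` with
`c = (1 - ψ) + ψ r₀/‖x‖`, `ψ = radialCut α β x`. [folklore] -/
theorem radialPush_eq_smul (x : 𝔼 2) :
    radialPush α β r₀ x = ((1 - radialCut α β x) + radialCut α β x * (r₀ / ‖x‖)) • x := by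
  rw [radialPush]
  module

/-- The radial push is the identity on `‖x‖ ≤ α`. [folklore] -/
theorem radialPush_of_le (hαβ : α < β) {x : 𝔼 2} (hx : ‖x‖ ≤ α) : radialPush α β r₀ x = x := by
  rw [radialPush, radialCut_of_le hαβ hx, zero_smul, add_zero]

/-- The radial push is the retraction `x ↦ r₀ • x/‖x‖` on `β ≤ ‖x‖`. [folklore] -/
theorem radialPush_of_ge (hαβ : α < β) {x : 𝔼 2} (hx : β ≤ ‖x‖) : radialPush α β r₀ x = (r₀ / ‖x‖) • x := by
  rw [radialPush, radialCut_of_ge hαβ hx, one_smul, add_sub_cancel]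

/-- **The norm of the radial push** is the interpolation `(1 - ψ) ‖x‖ + ψ r₀` (for `x ≠ 0`, `r₀ ≥ 0`).
[folklore] -/
theorem norm_radialPush (hr₀ : 0 ≤ r₀) {x : 𝔼 2} (hx : x ≠ 0) :
    ‖radialPush α β r₀ x‖ = (1 - radialCut α β x) * ‖x‖ + radialCut α β x * r₀ := by
  have hx0 : 0 < ‖x‖ := norm_pos_iff.2 hx
  obtain ⟨h0, h1⟩ := radialCut_mem (γ₁ := α) (γ₂ := β) x
  have hc : 0 ≤ (1 - radialCut α β x) + radialCut α β x * (r₀ / ‖x‖) := by positivity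
  rw [radialPush_eq_smul, norm_smul, Real.norm_of_nonneg hc]
  field_simp

/-- The norm of the radial push lies between `‖x‖` and `r₀`. [folklore] -/
theorem norm_radialPush_mem_uIcc (hr₀ : 0 ≤ r₀) {x : 𝔼 2} (hx : x ≠ 0) :
    min ‖x‖ r₀ ≤ ‖radialPush α β r₀ x‖ ∧ ‖radialPush α β r₀ x‖ ≤ max ‖x‖ r₀ := by
  rw [norm_radialPush hr₀ hx]
  obtain ⟨h0, h1⟩ := radialCut_mem (γ₁ := α) (γ₂ := β) x
  set ψ := radialCut α β x
  constructor
  · have hm1 : min ‖x‖ r₀ ≤ ‖x‖ := min_le_left _ _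
    have hm2 : min ‖x‖ r₀ ≤ r₀ := min_le_right _ _
    nlinarith
  · have hm1 : ‖x‖ ≤ max ‖x‖ r₀ := le_max_left _ _
    have hm2 : r₀ ≤ max ‖x‖ r₀ := le_max_right _ _
    nlinarith

/-- The radial push preserves the direction: `x/‖x‖` is unchanged (for `r₀ > 0`, `x ≠ 0`). [folklore] -/
theorem radialPush_eq_norm_smul (hr₀ : 0 < r₀) {x : 𝔼 2} (hx : x ≠ 0) :
    radialPush α β r₀ x = (‖radialPush α β r₀ x‖ / ‖x‖) • x := by
  have hx0 : 0 < ‖x‖ := norm_pos_iff.2 hx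
  rw [norm_radialPush hr₀.le hx]
  conv_lhs => rw [radialPush_eq_smul]
  congr 1
  field_simp

/-- On a cone point: `radialPush (t • u) = ‖radialPush (t • u)‖ • u`. [folklore] -/
theorem radialPush_smul_coe (hr₀ : 0 < r₀) {t : ℝ} (ht : 0 < t) (u : 𝕊 1) :
    radialPush α β r₀ (t • (u : 𝔼 2)) = ‖radialPush α β r₀ (t • (u : 𝔼 2))‖ • (u : 𝔼 2) := by
  have hx : t • (u : 𝔼 2) ≠ 0 := smul_ne_zero ht.ne' (ne_zero_of_mem_unit_sphere u)
  conv_lhs => rw [radialPush_eq_norm_smul hr₀ hx]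
  rw [smul_smul, norm_smul_coe_sphere ht.le, div_mul_cancel₀ _ ht.ne']

/-- **The radial push is `C^∞`** (for `0 < α < β`). [folklore] -/
theorem contDiff_radialPush (hα : 0 < α) (hαβ : α < β) : ContDiff ℝ ∞ (radialPush α β r₀) := by
  rw [contDiff_iff_contDiffAt]
  intro x
  by_cases hx : ‖x‖ < α
  · -- near `x` the push is the identity
    have hev : radialPush α β r₀ =ᶠ[𝓝 x] id :=
      Filter.eventuallyEq_of_mem ((isOpen_lt continuous_norm continuous_const).mem_nhds hx)
        fun y hy ↦ radialPush_of_le hαβ (le_of_lt hy)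
    exact contDiffAt_id.congr_of_eventuallyEq hev
  · have hx0 : x ≠ 0 := by
      rw [← norm_pos_iff]; linarith [not_lt.1 hx]
    have hn : ContDiffAt ℝ ∞ (fun y : 𝔼 2 ↦ ‖y‖) x := contDiffAt_norm ℝ hx0
    unfold radialPush
    exact contDiffAt_id.add ((contDiff_radialCut hα hαβ).contDiffAt.smul
      (((contDiffAt_const.div hn (norm_ne_zero_iff.2 hx0)).smul contDiffAt_id).sub contDiffAt_id))

end Radial

/-! ### Linear algebra of frames of a plane in `ℝ⁴` -/

section Frames

/-- **The linear map `a ↦ ∑ aⱼ • Bⱼ`** of a pair of vectors. [folklore] -/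
def frameCLM (B : Fin 2 → 𝔼 4) : 𝔼 2 →L[ℝ] 𝔼 4 :=
  ∑ j : Fin 2, (EuclideanSpace.proj j : 𝔼 2 →L[ℝ] ℝ).smulRight (B j)

/-- Unfolding of `frameCLM`. [folklore] -/
theorem frameCLM_apply (B : Fin 2 → 𝔼 4) (a : 𝔼 2) : frameCLM B a = ∑ j : Fin 2, a j • B j := by
  simp [frameCLM]

/-- `frameCLM B eⱼ = Bⱼ`. [folklore] -/
theorem frameCLM_single (B : Fin 2 → 𝔼 4) (j : Fin 2) :
    frameCLM B (EuclideanSpace.single j 1) = B j := by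
  rw [frameCLM_apply, Fin.sum_univ_two]
  fin_cases j <;> simp

/-- **`frameCLM B` is injective for an independent pair.** [folklore] -/
theorem injective_frameCLM {B : Fin 2 → 𝔼 4} (hB : LinearIndependent ℝ B) : Injective (frameCLM B) := by
  refine (injective_iff_map_eq_zero _).2 fun a ha ↦ ?_
  rw [frameCLM_apply] at ha
  have h := (Fintype.linearIndependent_iff.1 hB) (fun j ↦ a j) ha
  ext j
  simpa using h j

/-- The range of `frameCLM B` consists of the combinations `∑ cⱼ • Bⱼ`. [folklore] -/
theorem mem_range_frameCLM_iff (B : Fin 2 → 𝔼 4) (z : 𝔼 4) :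
    z ∈ LinearMap.range (frameCLM B : 𝔼 2 →ₗ[ℝ] 𝔼 4) ↔ ∃ c : Fin 2 → ℝ, ∑ j, c j • B j = z := by
  constructor
  · rintro ⟨a, rfl⟩
    exact ⟨fun j ↦ a j, by rw [ContinuousLinearMap.coe_coe, frameCLM_apply]⟩
  · rintro ⟨c, rfl⟩
    exact ⟨WithLp.toLp 2 c, by rw [ContinuousLinearMap.coe_coe, frameCLM_apply]⟩

/-- `frameCLM` is a `C^∞` function of the pair (it is linear in it): if `x ↦ Bⱼ x` are `C^∞` at `x₀`
then so is `x ↦ frameCLM (B · x)`. [folklore] -/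
theorem contDiffAt_frameCLM {X : Type*} [NormedAddCommGroup X] [NormedSpace ℝ X] {B : Fin 2 → X → 𝔼 4}
    {x₀ : X} (hB : ∀ j, ContDiffAt ℝ ∞ (B j) x₀) :
    ContDiffAt ℝ ∞ (fun x ↦ frameCLM (fun j ↦ B j x)) x₀ := by
  unfold frameCLM
  exact ContDiffAt.sum fun j _ ↦
    (contDiffAt_const (c := (EuclideanSpace.proj j : 𝔼 2 →L[ℝ] ℝ))).smulRight (hB j)

/-- **The coefficient map** of a pair: `frameCoeff B z = (βᵀβ)⁻¹ βᵀ z` for `β = frameCLM B` (the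
coordinates of the orthogonal projection of `z` onto the span of `B`). [folklore] -/
def frameCoeff (B : Fin 2 → 𝔼 4) (z : 𝔼 4) : 𝔼 2 :=
  (clmGram (frameCLM B)).inverse (clmAdj (frameCLM B) z)

/-- **The coefficients recover a vector of the span**: `∑ (frameCoeff B z)ⱼ • Bⱼ = z` for `z` in the
span of an independent pair `B`. [folklore] -/
theorem sum_frameCoeff_smul {B : Fin 2 → 𝔼 4} (hB : LinearIndependent ℝ B) {z : 𝔼 4}
    (hz : ∃ c : Fin 2 → ℝ, ∑ j, c j • B j = z) : ∑ j, (frameCoeff B z) j • B j = z := by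
  obtain ⟨a, rfl⟩ := (mem_range_frameCLM_iff B z).2 hz
  rw [← frameCLM_apply, frameCoeff, ← tangProj_apply, ContinuousLinearMap.coe_coe,
    tangProj_apply_map (injective_frameCLM hB)]

/-- **The coefficient map is `C^∞` in the pair and the vector** at pairs which are independent.
[folklore] -/
theorem contDiffAt_frameCoeff {X : Type*} [NormedAddCommGroup X] [NormedSpace ℝ X] {B : Fin 2 → X → 𝔼 4}
    {z : X → 𝔼 4} {x₀ : X} (hB : ∀ j, ContDiffAt ℝ ∞ (B j) x₀) (hz : ContDiffAt ℝ ∞ z x₀)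
    (hind : LinearIndependent ℝ (fun j ↦ B j x₀)) :
    ContDiffAt ℝ ∞ (fun x ↦ frameCoeff (fun j ↦ B j x) (z x)) x₀ := by
  have hβ := contDiffAt_frameCLM hB
  have h1 : ContDiffAt ℝ ∞ (fun x ↦ clmGram (frameCLM fun j ↦ B j x)) x₀ :=
    (contDiff_clmGram (F := 𝔼 4) (m := 2)).contDiffAt.comp x₀ hβ
  have hinv : ContDiffAt ℝ ∞ (ContinuousLinearMap.inverse ∘ fun x ↦ clmGram (frameCLM fun j ↦ B j x)) x₀ :=
    (isInvertible_clmGram (injective_frameCLM hind)).contDiffAt_map_inverse.comp x₀ h1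
  unfold frameCoeff
  exact hinv.clm_apply (((contDiff_clmAdj (F := 𝔼 4) (m := 2)).contDiffAt.comp x₀ hβ).clm_apply hz)

/-- **A normal vector lies in the span of a normal independent pair** (`(range L)ᗮ` is a plane for an
injective `L : ℝ² → ℝ⁴`). [folklore] -/
theorem exists_sum_smul_eq_of_normProj_eq {L : 𝔼 2 →L[ℝ] 𝔼 4} (hL : Injective L) {B : Fin 2 → 𝔼 4}
    (hB : LinearIndependent ℝ B) (hBn : ∀ j, normProj L (B j) = B j) {z : 𝔼 4} (hz : normProj L z = z) :
    ∃ c : Fin 2 → ℝ, ∑ j, c j • B j = z := by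
  set W : Submodule ℝ (𝔼 4) := (LinearMap.range (L : 𝔼 2 →ₗ[ℝ] 𝔼 4))ᗮ with hW
  -- `W` is a plane
  have h1 : Module.finrank ℝ (LinearMap.range (L : 𝔼 2 →ₗ[ℝ] 𝔼 4)) = 2 := by
    have h := LinearMap.finrank_range_of_inj (f := (L : 𝔼 2 →ₗ[ℝ] 𝔼 4)) hL
    rw [h, finrank_euclideanSpace_fin]
  have h2 : Module.finrank ℝ W = 2 := by
    have := Submodule.finrank_add_finrank_orthogonal (LinearMap.range (L : 𝔼 2 →ₗ[ℝ] 𝔼 4))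
    rw [h1, finrank_euclideanSpace_fin] at this
    rw [hW]
    omega
  -- normal vectors lie in `W`
  have hmem : ∀ {v : 𝔼 4}, normProj L v = v → v ∈ W := fun {v} hv ↦ by
    rw [hW, Submodule.mem_orthogonal]
    rintro _ ⟨a, rfl⟩
    exact (normProj_eq_self_iff hL v).1 hv a
  set B' : Fin 2 → W := fun j ↦ ⟨B j, hmem (hBn j)⟩ with hB'
  have hB'i : LinearIndependent ℝ B' := by
    refine LinearIndependent.of_comp W.subtype ?_
    exact hB
  let bW : Module.Basis (Fin 2) ℝ W := basisOfLinearIndependentOfCardEqFinrank hB'i (by simp [h2])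
  refine ⟨fun j ↦ bW.repr ⟨z, hmem hz⟩ j, ?_⟩
  have h := bW.sum_repr ⟨z, hmem hz⟩
  have h' := congrArg (W.subtype) h
  rw [map_sum] at h'
  simpa [bW, hB'] using h'

/-- **An independent pair of plane vectors has nonzero determinant.** [folklore] -/
theorem det_two_ne_zero_of_linearIndependent {p q : 𝔼 2} (h : LinearIndependent ℝ ![p, q]) :
    p 0 * q 1 - q 0 * p 1 ≠ 0 := by
  intro hdet
  rw [Fintype.linearIndependent_iff] at h
  -- the combination `q₁ • p - p₁ • q` vanishes
  have hcomb : ∀ c : Fin 2 → ℝ, c 0 • p + c 1 • q = 0 → c 0 = 0 ∧ c 1 = 0 := fun c hc ↦ by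
    have := h c (by rw [Fin.sum_univ_two]; simpa using hc)
    exact ⟨this 0, this 1⟩
  have h1 := hcomb ![q 1, -p 1] (by
    ext i; fin_cases i
    · simp; linarith
    · simp; ring)
  simp only [Matrix.cons_val_zero, Matrix.cons_val_one, neg_eq_zero] at h1
  obtain ⟨hq1, hp1⟩ := h1
  -- now `p = (p₀, 0)`, `q = (q₀, 0)`
  have h2 := hcomb ![q 0, -p 0] (by
    ext i; fin_cases i
    · simp; ring
    · simp [hq1, hp1])
  simp only [Matrix.cons_val_zero, Matrix.cons_val_one, neg_eq_zero] at h2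
  obtain ⟨hq0, hp0⟩ := h2
  have h3 := hcomb ![1, 0] (by
    ext i; fin_cases i
    · simp [hp0]
    · simp [hp1])
  simp at h3

end Frames

end Literature.Topology.FourManifolds
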